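import Mathlib
import Summits.Ventures.PercRepro.TriangleCapNineSixteenA
import Summits.Ventures.PercRepro.TriangleCapTwoBelowDiagonalTen

/-!
# PercRepro — TWO BELOW THE DIAGONAL IS EXACT ON THE `K₄⁻`-FREE CLASS FOR EVERY `k ≥ 9` (p3, gen 37; part 72)

At `k = 9` the only cell two below the diagonal in the dense corner is `(9, 16)` (`16 = 3·6 − 2`; `12 = 2·7 − 2` is
not dense, `18 = 4·5 − 2` is a product), settled by `dense_stability_two_nine_sixteen`; `k ≥ 10` is
TriangleCapTwoBelowDiagonalTen.

* **`cell_nine_sixteen_k4m`** — `2·cherries ≤ 100` on `K₄⁻`-free graphs on `9` vertices with `16` edges, attained;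
* **`two_below_diagonal_exact_k4m_of_nine`** — for `k ≥ 9` and `m = a(k − a) − 2 ≥ 2k − 3` with `m, m + 1` not of
  the form `a′(k − a′)`, the `K₄⁻`-free cherry maximum IS `(m(k − 2) − 2(k − 3))/2`.
The band of the closed form at `r = 2` on the `K₄⁻`-free class is now the single cell `(8, 13)`.
Axioms: standard.
-/

namespace PercRepro

namespace TriangleCap

namespace C047

open Finset

variable {V : Type*} [Fintype V] [DecidableEq V]

/-- The cell `(9, 16)` on `K₄⁻`-free graphs: `2·cherries ≤ 100`, attained (by `K_{3,6}` minus two edges at a vertex). -/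
theorem cell_nine_sixteen_k4m :
    (∀ (D : SimpleGraph (Fin 9)) [DecidableRel D.Adj], K4mFree D → D.edgeFinset.card = 16 →
      2 * cherries D ≤ 100) ∧
    ∃ (D : SimpleGraph (Fin 9)) (_ : DecidableRel D.Adj), K4mFree D ∧ D.edgeFinset.card = 16 ∧
      2 * cherries D = 100 := by
  constructor
  · intro D _ hK hD
    have hcard : Fintype.card (Fin 9) = 9 := Fintype.card_fin 9
    have hnot : ¬ ∃ A : Finset (Fin 9), (∀ x y, D.Adj x y → (x ∈ A ↔ y ∉ A)) ∧ (missing D A Aᶜ).card ≤ 1 := by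
      rintro ⟨A, hA, hN⟩
      have hNX := card_missing_add_card_edges D A hA
      have hXc : Aᶜ.card = 9 - A.card := by
        have := card_add_card_compl A
        rw [hcard] at this
        omega
      have hXk : A.card ≤ 9 := by
        have := card_le_univ A
        rwa [hcard] at this
      rw [hXc, hD] at hNX
      have hprod : ∀ a', a' ≤ 9 → 16 ≠ a' * (9 - a') ∧ 17 ≠ a' * (9 - a') := by decide
      obtain ⟨h1, h2⟩ := hprod A.card hXk
      have : (missing D A Aᶜ).card = 0 ∨ (missing D A Aᶜ).card = 1 := by omega
      rcases this with h | h
      · rw [h] at hNX; exact h1 (by omega)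
      · rw [h] at hNX; exact h2 (by omega)
    have h1 := dense_stability_two_nine_sixteen D hK hcard hD hnot
    have h2 := two_mul_cherries_add D
    have h3 := sum_deg_eq D
    rw [hcard, hD] at h1
    rw [hD] at h3
    omega
  · refine ⟨bipMinusStar 9 3 2, inferInstance, k4mFree_bipMinusStar 9 3 2, ?_, ?_⟩
    · have := card_edges_bipMinusStar 9 3 2 (by norm_num) (by norm_num)
      omega
    · have h := two_mul_cherries_bipMinusStar 9 3 2 (by norm_num) (by norm_num) (by norm_num)
      norm_num at h
      omega

/-- **TWO BELOW THE DIAGONAL IS EXACT ON THE `K₄⁻`-FREE CLASS FOR EVERY `k ≥ 9`.** -/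
theorem two_below_diagonal_exact_k4m_of_nine (k a : ℕ) (hk : 9 ≤ k) (ha : 1 ≤ a) (hak : a + 2 ≤ k)
    (hdense : 2 * k ≤ a * (k - a) - 2 + 3)
    (hm : ∀ a', a' ≤ k → a * (k - a) - 2 ≠ a' * (k - a') ∧ a * (k - a) - 1 ≠ a' * (k - a')) :
    (∀ (D : SimpleGraph (Fin k)) [DecidableRel D.Adj], K4mFree D →
        D.edgeFinset.card = a * (k - a) - 2 →
        2 * cherries D + 2 * (k - 3) ≤ (a * (k - a) - 2) * (k - 2)) ∧
      ∃ (D : SimpleGraph (Fin k)) (_ : DecidableRel D.Adj), K4mFree D ∧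
        D.edgeFinset.card = a * (k - a) - 2 ∧ 2 * cherries D + 2 * (k - 3) = (a * (k - a) - 2) * (k - 2) := by
  rcases Nat.lt_or_ge k 10 with hk9 | hk10
  · have hk' : k = 9 := by omega
    subst hk'
    have ha7 : a ≤ 7 := by omega
    interval_cases a
    · norm_num at hdense
    · norm_num at hdense
    · -- `a = 3`: the cell `(9, 16)`
      have h := cell_nine_sixteen_k4m
      norm_num
      obtain ⟨h1, D, inst, h2, h3, h4⟩ := h
      exact ⟨fun D _ hK hD => by have := h1 D hK hD; omega, D, inst, h2, h3, by omega⟩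
    · exact absurd (by norm_num) (hm 3 (by norm_num)).1
    · exact absurd (by norm_num) (hm 3 (by norm_num)).1
    · -- `a = 6`: the same cell
      have h := cell_nine_sixteen_k4m
      norm_num
      obtain ⟨h1, D, inst, h2, h3, h4⟩ := h
      exact ⟨fun D _ hK hD => by have := h1 D hK hD; omega, D, inst, h2, h3, by omega⟩
    · norm_num at hdense
  · exact two_below_diagonal_exact_k4m_of_ten k a hk10 ha hak hdense hm

end C047

end TriangleCap

end PercRepro
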